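import Summits.CriticalPhenomena.PercolationContinuityZ3.Theorems.Transplant.FKConnectivityAllQExchangeFar
import Summits.CriticalPhenomena.PercolationContinuityZ3.Theorems.PercNearOneGluingNoHeavyLowerTailFKExactEval
import HarnessLib

/-!
# Connectivity correlation inequalities for `φ_{w,q}` — the FAR exchange inequality ALSO fails for small `q`: refutation of the node
# `ExchangeFarFKPos` by an exact computation on a 5-vertex graph at `q = 1/100`

Support file (`--supports stmt-CriticalPhenomena-4575`), FK sub-lane `prim-bschramm-fk-1` (gen 8) of the post-continuity
programme; builds on p205010 (kernel theorem, internal audit signed; external expert review pending).  One `abbrev` family and one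
`def` (the listed weighted graph, the event predicate), no named facts, no sorries; standard axioms (`decide`, no `native_decide`).

FINDING (same seat, same day as `…ExchangeFar.lean`).  The arboreal-gas limit of the FAR exchange inequality — a two-forest counting
inequality — holds in 3,449 of 3,450 random weighted instances on `≤ 7` vertices (kit j122542–43) and FAILS in one; the FK version fails
on the same data for `q ≤ 1/100`.  WITNESS: `V = Fin 5`, listed pairs `24, 14, 02, 04, 01, 03, 13, 12` with parameters
`(1/26, 9/109, 1/101, 3/53, ·, ·, 2/27, 1/26)` (`= λq/(1+λq)` for `λ = 4, 9, 1, 6, ·, ·, 8, 4`, `q = 1/100`), root `x = 1`, compared pair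
`f = 10`, far pair `g = 03` (the weight-1 cluster of `x` is `{1}`), `𝒰 = {S ∋ 2, 3, 4}`:
`Z₁₀Z₀₁(u₀₁ − u₁₀) = 2896886564581/252032117973177372480000 > 57617907197/5250669124441195260000 = Z₁₁Z₀₀(u₁₁ − u₀₀)` (gap 4.7 %).
So neither the root form (`…ExchangeCex.lean`) nor the far form of 'MM coefficientwise in one activity' holds for all `q`; the
reductions `K₀ ⇒ MM`, `FAR ∧ STAR ⇒ MM` stand as theorems, and MM itself (`ClusterDomAdjFKPos`) remains clean in every census
(including the arboreal regime: its forest limit 0 violations / 3,200).  (refuted-substantive for the node as filed `∀ q > 0`.)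
[cite: Grimmett2006, §1.4 eq. (1.20) (p. 15); §3.9 (p. 63)] [cite: AyyerLinussonRavichandran2025, §7 Conj. 7.1 (p. 22)]
-/

noncomputable section

namespace Summit.CriticalPhenomena.PercolationContinuityZ3.Theorems

namespace FK

open MeasureTheory Set Literature.Probability.LatticeModels Literature.Probability.Percolation
open scoped Classical

namespace ExchangeFarCex

/-- The listed weighted graph on `Fin 5`: pairs `24, 14, 02, 04, 01, 03, 13, 12` with parameters `(1/26, 9/109, 1/101, 3/53, a, b, 2/27, 1/26)`,
`q = 1/100`; `a`, `b` are the states of `f = 01` and `g = 03`. [cite: Grimmett2006, §1.4 eq. (1.20) (p. 15)] -/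
abbrev dab (a b : ℚ) : RCEval :=
  ⟨5, 8, ![2, 1, 0, 0, 0, 0, 1, 1], ![4, 4, 2, 4, 1, 3, 3, 2], ![1 / 26, 9 / 109, 1 / 101, 3 / 53, a, b, 2 / 27, 1 / 26], 1 / 100⟩

/-- Validity of the base data set. [folklore] -/
theorem valid_hh : (dab (1 / 2) (1 / 2)).Valid := by decide +kernel
/-- Validity, state `(1,1)`. [folklore] -/
theorem valid_11 : (dab 1 1).Valid := by decide +kernel
/-- Validity, state `(1,0)`. [folklore] -/
theorem valid_10 : (dab 1 0).Valid := by decide +kernel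
/-- Validity, state `(0,1)`. [folklore] -/
theorem valid_01 : (dab 0 1).Valid := by decide +kernel
/-- Validity, state `(0,0)`. [folklore] -/
theorem valid_00 : (dab 0 0).Valid := by decide +kernel

/-- Computable predicate of `{C_1 ∋ 2, 3, 4}`. [folklore] -/
def pU (a b : ℚ) (t : Finset (Fin 8)) : Bool := (dab a b).reachB t 1 2 && ((dab a b).reachB t 1 3 && (dab a b).reachB t 1 4)

/-- `Z₁₁`. [cite: Grimmett2006, §1.4 eq. (1.20) (p. 15)] -/
theorem z11 : (dab 1 1).ZQ = 455179 / 3034080400 := by decide +kernel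
/-- `Z₁₀`. [cite: Grimmett2006, §1.4 eq. (1.20) (p. 15)] -/
theorem z10 : (dab 1 0).ZQ = 455179 / 36408964800 := by decide +kernel
/-- `Z₀₁`. [cite: Grimmett2006, §1.4 eq. (1.20) (p. 15)] -/
theorem z01 : (dab 0 1).ZQ = 89119 / 4930380650 := by decide +kernel
/-- `Z₀₀`. [cite: Grimmett2006, §1.4 eq. (1.20) (p. 15)] -/
theorem z00 : (dab 0 0).ZQ = 148301 / 236658271200 := by decide +kernel

/-- Mass of `{C_1 ∋ 2,3,4}`, state `(1,1)`. [cite: Grimmett2006, §1.4 eq. (1.20) (p. 15)] -/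
theorem m11 : (dab 1 1).massQ (pU 1 1) = 319872 / 2465190325 := by decide +kernel
/-- Mass of `{C_1 ∋ 2,3,4}`, state `(1,0)`. [cite: Grimmett2006, §1.4 eq. (1.20) (p. 15)] -/
theorem m10 : (dab 1 0).massQ (pU 1 0) = 213248 / 22186712925 := by decide +kernel
/-- Mass of `{C_1 ∋ 2,3,4}`, state `(0,1)`. [cite: Grimmett2006, §1.4 eq. (1.20) (p. 15)] -/
theorem m01 : (dab 0 1).massQ (pU 0 1) = 7889227 / 532481110200 := by decide +kernel
/-- Mass of `{C_1 ∋ 2,3,4}`, state `(0,0)`. [cite: Grimmett2006, §1.4 eq. (1.20) (p. 15)] -/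
theorem m00 : (dab 0 0).massQ (pU 0 0) = 4801 / 10240021350 := by decide +kernel

/-- The up-set `{S ∋ 2, 3, 4}`. [folklore] -/
theorem isUpperSet_U : IsUpperSet {S : Set (Fin 5) | (2 : Fin 5) ∈ S ∧ (3 : Fin 5) ∈ S ∧ (4 : Fin 5) ∈ S} :=
  fun _ _ h hS => ⟨h hS.1, h hS.2.1, h hS.2.2⟩

/-- `conf t ∈ {C_1 ∋ 2, 3, 4}` iff `pU`. [folklore] -/
theorem conf_mem_iff (a b : ℚ) (t : Finset (Fin 8)) :
    (dab a b).conf t ∈ clusterIn (1 : Fin 5) {S : Set (Fin 5) | (2 : Fin 5) ∈ S ∧ (3 : Fin 5) ∈ S ∧ (4 : Fin 5) ∈ S} ↔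
      pU a b t = true := by
  unfold pU
  rw [Bool.and_eq_true, Bool.and_eq_true, RCEval.reachB_iff, RCEval.reachB_iff, RCEval.reachB_iff]
  rfl

/-- **The parameter vectors of `dab a b` are the two-point updates of that of `dab ½ ½`.** [cite: Grimmett2006, §1.4 eq. (1.20) (p. 15)] -/
theorem dab_w (a b : ℚ) (hv : (dab a b).Valid) (A B : unitInterval) (hA : (A : ℝ) = a) (hB : (B : ℝ) = b) :
    ((dab a b).w : Sym2 (Fin 5) → unitInterval) =
      Function.update (Function.update ((dab (1 / 2) (1 / 2)).w : Sym2 (Fin 5) → unitInterval)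
        s((1 : Fin 5), (0 : Fin 5)) A) s((0 : Fin 5), (3 : Fin 5)) B := by
  have hv0 := valid_hh
  have hedge : (dab a b).edge = (dab (1 / 2) (1 / 2)).edge := rfl
  have e5 : (dab a b).edge 5 = s((0 : Fin 5), (3 : Fin 5)) := rfl
  have e4 : (dab a b).edge 4 = s((1 : Fin 5), (0 : Fin 5)) := Sym2.eq_swap
  funext e
  by_cases h2 : e = s((0 : Fin 5), (3 : Fin 5))
  · subst h2
    rw [Function.update_self]
    apply Subtype.ext
    rw [hB, ← e5, RCEval.w_edge hv 5]
    rfl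
  · rw [Function.update_of_ne h2]
    by_cases h0 : e = s((1 : Fin 5), (0 : Fin 5))
    · subst h0
      rw [Function.update_self]
      apply Subtype.ext
      rw [hA, ← e4, RCEval.w_edge hv 4]
      rfl
    · rw [Function.update_of_ne h0]
      apply Subtype.ext
      by_cases hr : e ∈ Set.range (dab a b).edge
      · obtain ⟨i, rfl⟩ := hr
        have hi4 : i ≠ 4 := fun h => h0 (by rw [h, e4])
        have hi5 : i ≠ 5 := fun h => h2 (by rw [h, e5])
        rw [RCEval.w_edge hv i, hedge, RCEval.w_edge hv0 i]
        fin_cases i <;> simp_all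
      · rw [RCEval.w_eq_zero_of_notMem_range hr]
        rw [hedge] at hr
        rw [RCEval.w_eq_zero_of_notMem_range hr]

/-- Every parameter of the base vector is `< 1`, so `w[f ↦ 0]` has no parameter-1 pair (for any decidability instance used by
`Function.update`). [folklore] -/
theorem oneSet_base_update_eq_empty (inst : DecidableEq (Sym2 (Fin 5))) :
    oneSet (@Function.update (Sym2 (Fin 5)) (fun _ => unitInterval) inst ((dab (1 / 2) (1 / 2)).w)
      s((1 : Fin 5), (0 : Fin 5)) 0) = ∅ := by
  have hv0 := valid_hh
  ext e
  simp only [oneSet, mem_setOf_eq, mem_empty_iff_false, iff_false]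
  by_cases h0 : e = s((1 : Fin 5), (0 : Fin 5))
  · subst h0; simp
  · rw [Function.update_of_ne h0]
    intro h1
    have hc : ((dab (1 / 2) (1 / 2)).w e : ℝ) = 1 := by rw [h1]; rfl
    by_cases hr : e ∈ Set.range (dab (1 / 2) (1 / 2)).edge
    · obtain ⟨i, rfl⟩ := hr
      rw [RCEval.w_edge hv0 i] at hc
      fin_cases i <;> simp at hc <;> norm_num at hc
    · rw [RCEval.w_eq_zero_of_notMem_range hr] at hc
      norm_num at hc

end ExchangeFarCex

open ExchangeFarCex

/-- **The FAR exchange inequality fails for small `q`: `¬ ExchangeFarFKPos`.**  Witness: the 5-vertex graph with pairs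
`24, 14, 02, 04, 01, 03, 13, 12`, parameters `(1/26, 9/109, 1/101, 3/53, ·, ·, 2/27, 1/26)`, `q = 1/100`, `x = 1`, `f = 10`, far pair `g = 03`,
`𝒰 = {S ∋ 2,3,4}`: `Z₁₀Z₀₁(u₀₁−u₁₀) > Z₁₁Z₀₀(u₁₁−u₀₀)` (gap 4.7 %).  (refuted-substantive: the arboreal limit of the far form is a
two-forest inequality that fails rarely — 1 / 3,450 sampled instances; MM itself is untouched.) [cite: Grimmett2006, §1.4 eq. (1.20) (p. 15); §3.9 (p. 63)] -/
theorem not_exchangeFarFKPos : ¬ ExchangeFarFKPos := by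
  intro h
  have hq : (0 : ℝ) < ((1 / 100 : ℚ) : ℝ) := by norm_num
  have hbot : openGraph (∅ : BondConfig (Fin 5)) = ⊥ := by
    ext a b; simp [openGraph_adj]
  have key := h ((1 / 100 : ℚ) : ℝ) hq 5 (dab (1 / 2) (1 / 2)).w 1 0 s((0 : Fin 5), (3 : Fin 5))
    {S : Set (Fin 5) | (2 : Fin 5) ∈ S ∧ (3 : Fin 5) ∈ S ∧ (4 : Fin 5) ∈ S} isUpperSet_U (by
      intro y hy hreach
      rw [oneSet_base_update_eq_empty _, hbot, SimpleGraph.reachable_bot] at hreach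
      rw [Sym2.mem_iff] at hy
      rcases hy with rfl | rfl <;> exact absurd hreach (by decide))
  unfold exchIneq at key
  have c1 : ((1 : unitInterval) : ℝ) = ((1 : ℚ) : ℝ) := by simp
  have c0 : ((0 : unitInterval) : ℝ) = ((0 : ℚ) : ℝ) := by simp
  set X : Set (BondConfig (Fin 5)) :=
    clusterIn (1 : Fin 5) {S : Set (Fin 5) | (2 : Fin 5) ∈ S ∧ (3 : Fin 5) ∈ S ∧ (4 : Fin 5) ∈ S} with hX
  have key2 : rcPartitionFunctionW (dab 1 0).w ((1 / 100 : ℚ) : ℝ) ∅ * rcPartitionFunctionW (dab 0 1).w ((1 / 100 : ℚ) : ℝ) ∅ *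
        ((rcMeasureW (dab 0 1).w ((1 / 100 : ℚ) : ℝ) ∅).real X - (rcMeasureW (dab 1 0).w ((1 / 100 : ℚ) : ℝ) ∅).real X) ≤
      rcPartitionFunctionW (dab 1 1).w ((1 / 100 : ℚ) : ℝ) ∅ * rcPartitionFunctionW (dab 0 0).w ((1 / 100 : ℚ) : ℝ) ∅ *
        ((rcMeasureW (dab 1 1).w ((1 / 100 : ℚ) : ℝ) ∅).real X - (rcMeasureW (dab 0 0).w ((1 / 100 : ℚ) : ℝ) ∅).real X) := by
    rw [dab_w 1 1 valid_11 1 1 c1 c1, dab_w 1 0 valid_10 1 0 c1 c0, dab_w 0 1 valid_01 0 1 c0 c1, dab_w 0 0 valid_00 0 0 c0 c0]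
    convert key
  have hq11 : ((1 / 100 : ℚ) : ℝ) = (((dab 1 1).q : ℚ) : ℝ) := rfl
  rw [hq11] at key2
  rw [RCEval.rcPartitionFunctionW_eq valid_11, RCEval.rcPartitionFunctionW_eq valid_10, RCEval.rcPartitionFunctionW_eq valid_01,
    RCEval.rcPartitionFunctionW_eq valid_00,
    RCEval.real_eq_massQ_div valid_11 (P := pU 1 1) (conf_mem_iff 1 1),
    RCEval.real_eq_massQ_div valid_10 (P := pU 1 0) (conf_mem_iff 1 0),
    RCEval.real_eq_massQ_div valid_01 (P := pU 0 1) (conf_mem_iff 0 1),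
    RCEval.real_eq_massQ_div valid_00 (P := pU 0 0) (conf_mem_iff 0 0),
    z11, z10, z01, z00, m11, m10, m01, m00] at key2
  norm_num at key2

end FK

end Summit.CriticalPhenomena.PercolationContinuityZ3.Theorems

end
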